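import Mathlib.Analysis.SpecialFunctions.Pow.Deriv
import Mathlib.Analysis.SpecialFunctions.Pow.Asymptotics
import Mathlib.Analysis.Calculus.MeanValue
import Mathlib.Algebra.BigOperators.Module
import Mathlib.Analysis.Normed.Group.FunctionSeries
import Mathlib.Analysis.PSeries
import Mathlib.Topology.UniformSpace.LocallyUniformConvergence
import HarnessLib

/-!
# Abel summation for Dirichlet series over `ℕ` with bounded partial sums

Topic `Literature/NumberTheory/LFunctions` (trunk T-ANT). Elementary analysis used in the proof
of the `O(1)`-form of K. Conrad's Theorem 5.3 (*Partial Euler products on the critical line*,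
Canad. J. Math. **57** (2005), proof of Thm. 5.3, p. 279: "From this slow growth, `∑ bₙ n^{-s}`
converges for `Re(s) > 1/2` … `(log L)(s + 1/2) = s ∫₁^∞ A(x) x^{-s-1} dx`"), in the discrete
form of Abel's lemma: if the partial sums `A(N) = ∑_{n<N} aₙ` of a complex sequence are bounded,
`‖A(N)‖ ≤ M`, then

* `∑_{n<N} aₙ n^{-w} = (N-1)^{-w} A(N) - ∑_{i<N-1} ((i+1)^{-w} - i^{-w}) A(i+1)`
  (`sum_range_cpow_mul_eq`, Mathlib's `Finset.sum_range_by_parts`);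
* `‖(i+1)^{-w} - i^{-w}‖ ≤ ‖w‖ i^{-Re w - 1}` for `i ≥ 1`, `Re w ≥ 0`
  (`norm_cpow_neg_succ_sub_cpow_neg_le`, mean value theorem), so the transformed series
  converges absolutely and locally uniformly on `Re w > 0`, and the Dirichlet series
  `∑ₙ aₙ n^{-w}` (summed in order) converges locally uniformly on `Re w > 0` to
  the *Abel sum* `-∑ᵢ ((i+1)^{-w} - i^{-w}) A(i+1)`
  (`tendstoUniformlyOn_sum_range_cpow_mul`, `tendstoLocallyUniformlyOn_sum_range_cpow_mul`,
  `tendsto_sum_range_cpow_mul`);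
* for real `u > 0` the weights `n^{-u}` are positive and decreasing, and
  `‖∑ₙ aₙ n^{-u}‖ ≤ 2M` uniformly in `u` (`norm_abelSum_ofReal_le`).

All statements are folklore (e.g. Montgomery–Vaughan, *Multiplicative Number Theory I*, §1.2,
Thm. 1.3, or Apostol, *Introduction to Analytic Number Theory*, Thm. 4.2); they are proved here.

## References

* K. Conrad, *Partial Euler products on the critical line*, Canad. J. Math. 57 (2005) 267–297,
  proof of Thm. 5.3. [cite: Conrad2005PartialEuler]
-/

noncomputable section

open scoped Topology
open Filter Finset Complex Metric

namespace Literature.NumberTheory.LFunctions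

namespace PartialEuler

/-! ### The weights `n^{-w}` -/

/-- **Increment bound for the weights.** For `i ≥ 1` and `Re w ≥ 0`,
`‖(i+1)^{-w} - i^{-w}‖ ≤ ‖w‖ · i^{-Re w - 1}` (mean value theorem for `t ↦ t^{-w}` on
`[i, i+1]`, whose derivative `-w t^{-w-1}` has norm `≤ ‖w‖ i^{-Re w - 1}` there). [folklore] -/
theorem norm_cpow_neg_succ_sub_cpow_neg_le {i : ℕ} (hi : i ≠ 0) {w : ℂ} (hw : 0 ≤ w.re) :
    ‖((i + 1 : ℕ) : ℂ) ^ (-w) - (i : ℂ) ^ (-w)‖ ≤ ‖w‖ * (i : ℝ) ^ (-w.re - 1) := by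
  by_cases hw0 : w = 0
  · subst hw0
    simp
  have hipos : (0 : ℝ) < i := by exact_mod_cast Nat.pos_of_ne_zero hi
  -- the function and its derivative on `[i, i+1]`
  have hderiv : ∀ t ∈ Set.Icc (i : ℝ) (i + 1),
      HasDerivWithinAt (fun y : ℝ => (y : ℂ) ^ (-w)) (-w * (t : ℂ) ^ (-w - 1))
        (Set.Icc (i : ℝ) (i + 1)) t := by
    intro t ht
    have ht0 : t ≠ 0 := by linarith [ht.1]
    exact (hasDerivAt_ofReal_cpow_const ht0 (neg_ne_zero.mpr hw0)).hasDerivWithinAt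
  have hbound : ∀ t ∈ Set.Icc (i : ℝ) (i + 1),
      ‖-w * (t : ℂ) ^ (-w - 1)‖ ≤ ‖w‖ * (i : ℝ) ^ (-w.re - 1) := by
    intro t ht
    have htpos : 0 < t := by linarith [ht.1]
    rw [norm_mul, norm_neg, norm_cpow_eq_rpow_re_of_pos htpos]
    refine mul_le_mul_of_nonneg_left ?_ (norm_nonneg _)
    have : (-w - 1).re = -w.re - 1 := by simp
    rw [this]
    exact Real.rpow_le_rpow_of_nonpos hipos ht.1 (by linarith)
  have key := (convex_Icc (i : ℝ) (i + 1)).norm_image_sub_le_of_norm_hasDerivWithin_le hderiv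
    hbound (Set.left_mem_Icc.mpr (by linarith)) (Set.right_mem_Icc.mpr (by linarith))
  have h1 : ‖((i : ℝ) + 1) - (i : ℝ)‖ = 1 := by simp
  rw [h1, mul_one] at key
  have e1 : ((i + 1 : ℕ) : ℂ) = (((i : ℝ) + 1 : ℝ) : ℂ) := by push_cast; ring
  have e2 : (i : ℂ) = ((i : ℝ) : ℂ) := by simp
  rw [e1, e2]
  exact key

/-- For real `u` and `i ≥ 1`, `i^{-u}` is the real number `i^{-u}`. [folklore] -/
theorem natCast_cpow_neg_ofReal {i : ℕ} (u : ℝ) :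
    (i : ℂ) ^ (-(u : ℂ)) = (((i : ℝ) ^ (-u) : ℝ) : ℂ) := by
  rw [show (i : ℂ) = ((i : ℝ) : ℂ) by simp, ← ofReal_neg, ← ofReal_cpow (Nat.cast_nonneg i)]

/-- For real `u > 0` the weights decrease: `(i+1)^{-u} ≤ i^{-u}` for `i ≥ 1`, so that
`‖(i+1)^{-u} - i^{-u}‖ = i^{-u} - (i+1)^{-u}`. [folklore] -/
theorem norm_cpow_neg_succ_sub_cpow_neg_ofReal {i : ℕ} (hi : i ≠ 0) {u : ℝ} (hu : 0 < u) :
    ‖((i + 1 : ℕ) : ℂ) ^ (-(u : ℂ)) - (i : ℂ) ^ (-(u : ℂ))‖ =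
      (i : ℝ) ^ (-u) - ((i + 1 : ℕ) : ℝ) ^ (-u) := by
  rw [natCast_cpow_neg_ofReal, natCast_cpow_neg_ofReal, ← ofReal_sub, norm_real,
    Real.norm_eq_abs, abs_sub_comm, abs_of_nonneg]
  have hipos : (0 : ℝ) < i := by exact_mod_cast Nat.pos_of_ne_zero hi
  have hle : (i : ℝ) ≤ ((i + 1 : ℕ) : ℝ) := by push_cast; linarith
  linarith [Real.rpow_le_rpow_of_nonpos hipos hle (neg_nonpos.mpr hu.le)]

/-! ### Abel summation -/

/-! Notation used in the docstrings below: `A(N) = ∑_{n<N} aₙ` (in Lean `∑ n ∈ range N, a n`),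
the *Abel term* `((i+1)^{-w} - i^{-w}) A(i+1)`, and the *Abel sum*
`-∑ᵢ ((i+1)^{-w} - i^{-w}) A(i+1)`; they are written out in full in every statement (this
proof file introduces no definitions). -/

/-- **Abel's summation by parts** for `∑_{n<N} aₙ n^{-w}`:
`∑_{n<N} n^{-w} aₙ = (N-1)^{-w} A(N) - ∑_{i<N-1} ((i+1)^{-w} - i^{-w}) A(i+1)`
(Mathlib's `Finset.sum_range_by_parts`). [folklore] -/
theorem sum_range_cpow_mul_eq (a : ℕ → ℂ) (w : ℂ) (N : ℕ) :
    ∑ n ∈ range N, (n : ℂ) ^ (-w) * a n =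
      ((N - 1 : ℕ) : ℂ) ^ (-w) * ∑ n ∈ range N, a n -
        ∑ i ∈ range (N - 1), ((((i + 1 : ℕ) : ℂ) ^ (-w)) - (i : ℂ) ^ (-w)) * ∑ n ∈ range (i + 1), a n := by
  have h := Finset.sum_range_by_parts (fun n : ℕ => (n : ℂ) ^ (-w)) a N
  simp only [smul_eq_mul] at h
  rw [h]

variable {a : ℕ → ℂ} {M : ℝ}

/-- The bound `M` on the partial sums is nonnegative (it bounds `‖A(0)‖ = 0`). [folklore] -/
theorem nonneg_of_norm_psum_le (hA : ∀ N, ‖∑ n ∈ range N, a n‖ ≤ M) : 0 ≤ M :=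
  (norm_nonneg _).trans (hA 0)

/-- Bound for the general term, `i ≥ 1`, `Re w ≥ 0`:
`‖((i+1)^{-w} - i^{-w}) A(i+1)‖ ≤ M ‖w‖ i^{-Re w - 1}`. [folklore] -/
theorem norm_abelTerm_le (hA : ∀ N, ‖∑ n ∈ range N, a n‖ ≤ M) {w : ℂ} (hw : 0 ≤ w.re) {i : ℕ}
    (hi : i ≠ 0) :
    ‖((((i + 1 : ℕ) : ℂ) ^ (-w)) - (i : ℂ) ^ (-w)) * ∑ n ∈ range (i + 1), a n‖ ≤
      M * (‖w‖ * (i : ℝ) ^ (-w.re - 1)) := by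
  rw [norm_mul, mul_comm M]
  exact mul_le_mul (norm_cpow_neg_succ_sub_cpow_neg_le hi hw) (hA _) (norm_nonneg _)
    (by positivity)

/-- Bound for the term `i = 0` (`w ≠ 0`): `‖(1^{-w} - 0^{-w}) A(1)‖ ≤ M`. [folklore] -/
theorem norm_abelTerm_zero_le (hA : ∀ N, ‖∑ n ∈ range N, a n‖ ≤ M) {w : ℂ} (hw : w ≠ 0) :
    ‖((((0 + 1 : ℕ) : ℂ) ^ (-w)) - ((0 : ℕ) : ℂ) ^ (-w)) * ∑ n ∈ range (0 + 1), a n‖ ≤ M := by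
  rw [Nat.cast_zero, zero_cpow (neg_ne_zero.mpr hw)]
  simpa using hA 1

/-- Bound for the general term at a real point `u > 0`, `i ≥ 1`:
`‖((i+1)^{-u} - i^{-u}) A(i+1)‖ ≤ M (i^{-u} - (i+1)^{-u})`. [folklore] -/
theorem norm_abelTerm_ofReal_le (hA : ∀ N, ‖∑ n ∈ range N, a n‖ ≤ M) {u : ℝ} (hu : 0 < u) {i : ℕ}
    (hi : i ≠ 0) :
    ‖((((i + 1 : ℕ) : ℂ) ^ (-(u : ℂ))) - (i : ℂ) ^ (-(u : ℂ))) * ∑ n ∈ range (i + 1), a n‖ ≤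
      M * ((i : ℝ) ^ (-u) - ((i + 1 : ℕ) : ℝ) ^ (-u)) := by
  rw [norm_mul, mul_comm M, norm_cpow_neg_succ_sub_cpow_neg_ofReal hi hu]
  refine mul_le_mul_of_nonneg_left (hA _) ?_
  rw [← norm_cpow_neg_succ_sub_cpow_neg_ofReal hi hu]
  exact norm_nonneg _

/-- A summable majorant of the Abel terms, uniformly on `{δ ≤ Re w, ‖w‖ ≤ R}` (`δ > 0`):
`mⱼ = M` for `i = 0` and `M R i^{-δ-1}` for `i ≥ 1`. [folklore] -/
theorem summable_abelMajorant (M R : ℝ) {δ : ℝ} (hδ : 0 < δ) :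
    Summable fun i : ℕ => if i = 0 then M else M * (R * (i : ℝ) ^ (-δ - 1)) := by
  have h : Summable fun i : ℕ => M * (R * (i : ℝ) ^ (-δ - 1)) :=
    ((Real.summable_nat_rpow.mpr (by linarith)).mul_left R).mul_left M
  refine (summable_nat_add_iff 1).mp ?_
  simpa using (summable_nat_add_iff 1).mpr h

/-- On `{δ ≤ Re w, ‖w‖ ≤ R}` the Abel terms are dominated by the majorant of
`summable_abelMajorant`. [folklore] -/
theorem norm_abelTerm_le_majorant (hA : ∀ N, ‖∑ n ∈ range N, a n‖ ≤ M) {δ R : ℝ} (hδ : 0 < δ) {w : ℂ}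
    (hw : δ ≤ w.re ∧ ‖w‖ ≤ R) (i : ℕ) :
    ‖((((i + 1 : ℕ) : ℂ) ^ (-w)) - (i : ℂ) ^ (-w)) * ∑ n ∈ range (i + 1), a n‖ ≤
      if i = 0 then M else M * (R * (i : ℝ) ^ (-δ - 1)) := by
  have hM := nonneg_of_norm_psum_le hA
  have hw0 : w ≠ 0 := by
    rintro rfl
    simp at hw
    linarith
  split_ifs with hi
  · subst hi
    exact norm_abelTerm_zero_le hA hw0
  · refine (norm_abelTerm_le hA (hδ.le.trans hw.1) hi).trans ?_
    refine mul_le_mul_of_nonneg_left ?_ hM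
    have hipos : (0 : ℝ) < i := by exact_mod_cast Nat.pos_of_ne_zero hi
    have hi1 : (1 : ℝ) ≤ i := by exact_mod_cast Nat.pos_of_ne_zero hi
    refine mul_le_mul hw.2 ?_ (by positivity) ((norm_nonneg _).trans hw.2)
    exact Real.rpow_le_rpow_of_exponent_le hi1 (by linarith [hw.1])

/-- The Abel series converges absolutely for `Re w > 0` (norms). [folklore] -/
theorem summable_norm_abelTerm (hA : ∀ N, ‖∑ n ∈ range N, a n‖ ≤ M) {w : ℂ} (hw : 0 < w.re) :
    Summable fun i : ℕ => ‖((((i + 1 : ℕ) : ℂ) ^ (-w)) - (i : ℂ) ^ (-w)) * ∑ n ∈ range (i + 1), a n‖ :=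
  .of_nonneg_of_le (fun _ => norm_nonneg _) (norm_abelTerm_le_majorant hA hw ⟨le_rfl, le_rfl⟩)
    (summable_abelMajorant M ‖w‖ hw)

/-- The Abel series converges absolutely for `Re w > 0`. [folklore] -/
theorem summable_abelTerm (hA : ∀ N, ‖∑ n ∈ range N, a n‖ ≤ M) {w : ℂ} (hw : 0 < w.re) :
    Summable fun i : ℕ => ((((i + 1 : ℕ) : ℂ) ^ (-w)) - (i : ℂ) ^ (-w)) * ∑ n ∈ range (i + 1), a n :=
  (summable_norm_abelTerm hA hw).of_norm

/-- **Uniform convergence on half-strips.** If `‖A(N)‖ ≤ M` for all `N`, then for `δ > 0` the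
partial sums `∑_{n<N} aₙ n^{-w}` converge to the Abel sum `-∑ᵢ ((i+1)^{-w} - i^{-w}) A(i+1)` uniformly on
`{w | δ ≤ Re w, ‖w‖ ≤ R}`: the Abel series converges uniformly by the Weierstrass `M`-test and
the boundary term `(N-1)^{-w} A(N)` is `≤ M (N-1)^{-δ}` in norm. [folklore] -/
theorem tendstoUniformlyOn_sum_range_cpow_mul (hA : ∀ N, ‖∑ n ∈ range N, a n‖ ≤ M) {δ : ℝ} (hδ : 0 < δ)
    (R : ℝ) :
    TendstoUniformlyOn (fun N w => ∑ n ∈ range N, (n : ℂ) ^ (-w) * a n)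
      (fun w => -∑' i : ℕ, ((((i + 1 : ℕ) : ℂ) ^ (-w)) - (i : ℂ) ^ (-w)) * ∑ n ∈ range (i + 1), a n)
      atTop {w : ℂ | δ ≤ w.re ∧ ‖w‖ ≤ R} := by
  have hM := nonneg_of_norm_psum_le hA
  set K : Set ℂ := {w : ℂ | δ ≤ w.re ∧ ‖w‖ ≤ R} with hK
  -- the Abel terms, as a function of `(i, w)`
  set T : ℕ → ℂ → ℂ := fun i w => ((((i + 1 : ℕ) : ℂ) ^ (-w)) - (i : ℂ) ^ (-w)) * ∑ n ∈ range (i + 1), a n with hT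
  -- uniform convergence of the Abel series (M-test)
  have hser : TendstoUniformlyOn (fun N w => ∑ i ∈ range N, T i w)
      (fun w => ∑' i, T i w) atTop K :=
    tendstoUniformlyOn_tsum_nat (summable_abelMajorant M R hδ)
      fun i w hw => norm_abelTerm_le_majorant hA hδ hw i
  rw [Metric.tendstoUniformlyOn_iff] at hser ⊢
  intro ε hε
  -- the boundary term is eventually `< ε/2` uniformly on `K`
  have hbdry : ∀ᶠ N : ℕ in atTop, ∀ w ∈ K,
      ‖((N - 1 : ℕ) : ℂ) ^ (-w) * ∑ n ∈ range N, a n‖ < ε / 2 := by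
    have ht : Tendsto (fun N : ℕ => (M + 1) * ((N - 1 : ℕ) : ℝ) ^ (-δ)) atTop (𝓝 0) := by
      rw [← mul_zero (M + 1)]
      refine Tendsto.const_mul _ ?_
      have h1 : Tendsto (fun N : ℕ => ((N - 1 : ℕ) : ℝ)) atTop atTop :=
        tendsto_natCast_atTop_atTop.comp (tendsto_sub_atTop_nat 1)
      exact (tendsto_rpow_neg_atTop hδ).comp h1
    filter_upwards [(tendsto_order.mp ht).2 _ (half_pos hε), eventually_ge_atTop 2] with N hN hN2
      w hw
    have hN1 : (N - 1 : ℕ) ≠ 0 := by omega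
    have hpos : (0 : ℝ) < ((N - 1 : ℕ) : ℝ) := by exact_mod_cast Nat.pos_of_ne_zero hN1
    calc ‖((N - 1 : ℕ) : ℂ) ^ (-w) * ∑ n ∈ range N, a n‖
        = ((N - 1 : ℕ) : ℝ) ^ (-w.re) * ‖∑ n ∈ range N, a n‖ := by
          rw [norm_mul, norm_natCast_cpow_of_pos (Nat.pos_of_ne_zero hN1), neg_re]
      _ ≤ ((N - 1 : ℕ) : ℝ) ^ (-δ) * (M + 1) := by
          refine mul_le_mul ?_ ((hA N).trans (by linarith)) (norm_nonneg _) (by positivity)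
          exact Real.rpow_le_rpow_of_exponent_le (by exact_mod_cast Nat.pos_of_ne_zero hN1)
            (by linarith [hw.1])
      _ = (M + 1) * ((N - 1 : ℕ) : ℝ) ^ (-δ) := by ring
      _ < ε / 2 := hN
  obtain ⟨N₁, hN₁⟩ := eventually_atTop.mp (hser (ε / 2) (half_pos hε))
  obtain ⟨N₂, hN₂⟩ := eventually_atTop.mp hbdry
  refine eventually_atTop.mpr ⟨max (N₁ + 1) N₂, fun N hN w hw => ?_⟩
  have h1 : ‖∑ i ∈ range (N - 1), T i w - ∑' i, T i w‖ < ε / 2 := by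
    have := hN₁ (N - 1) (by omega) w hw
    rwa [dist_eq_norm, norm_sub_rev] at this
  have h2 := hN₂ N (le_of_max_le_right hN) w hw
  rw [sum_range_cpow_mul_eq, dist_eq_norm]
  change ‖-∑' i, T i w - (((N - 1 : ℕ) : ℂ) ^ (-w) * ∑ n ∈ range N, a n -
    ∑ i ∈ range (N - 1), T i w)‖ < ε
  calc ‖-∑' i, T i w - (((N - 1 : ℕ) : ℂ) ^ (-w) * ∑ n ∈ range N, a n -
          ∑ i ∈ range (N - 1), T i w)‖
      = ‖(∑ i ∈ range (N - 1), T i w - ∑' i, T i w) -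
          ((N - 1 : ℕ) : ℂ) ^ (-w) * ∑ n ∈ range N, a n‖ := by
        congr 1
        ring
    _ ≤ ‖∑ i ∈ range (N - 1), T i w - ∑' i, T i w‖ +
          ‖((N - 1 : ℕ) : ℂ) ^ (-w) * ∑ n ∈ range N, a n‖ := norm_sub_le _ _
    _ < ε / 2 + ε / 2 := add_lt_add h1 h2
    _ = ε := by ring

/-- **Locally uniform convergence on `Re w > 0`.** If `‖A(N)‖ ≤ M` for all `N`, the partial
sums `∑_{n<N} aₙ n^{-w}` converge to the Abel sum locally uniformly on the open half-plane
`Re w > 0` (every compact subset lies in a half-strip `{δ ≤ Re w, ‖w‖ ≤ R}`). [folklore] -/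
theorem tendstoLocallyUniformlyOn_sum_range_cpow_mul (hA : ∀ N, ‖∑ n ∈ range N, a n‖ ≤ M) :
    TendstoLocallyUniformlyOn (fun N w => ∑ n ∈ range N, (n : ℂ) ^ (-w) * a n)
      (fun w => -∑' i : ℕ, ((((i + 1 : ℕ) : ℂ) ^ (-w)) - (i : ℂ) ^ (-w)) * ∑ n ∈ range (i + 1), a n)
      atTop {w : ℂ | 0 < w.re} := by
  rw [tendstoLocallyUniformlyOn_iff_forall_isCompact (isOpen_lt continuous_const continuous_re)]
  intro K hKU hK
  rcases K.eq_empty_or_nonempty with rfl | hne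
  · exact fun u _ => by simp
  -- `δ = min Re w` over `K`, `R = max ‖w‖`
  obtain ⟨w₀, hw₀K, hw₀⟩ := hK.exists_isMinOn hne continuous_re.continuousOn
  obtain ⟨w₁, hw₁K, hw₁⟩ := hK.exists_isMaxOn hne continuous_norm.continuousOn
  have hδ : 0 < w₀.re := hKU hw₀K
  refine (tendstoUniformlyOn_sum_range_cpow_mul hA hδ ‖w₁‖).mono fun w hw => ?_
  exact ⟨hw₀ hw, hw₁ hw⟩

/-- **Convergence of the Dirichlet series.** If `‖A(N)‖ ≤ M` for all `N` and `Re w > 0`, then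
`∑_{n<N} aₙ n^{-w} → -∑ᵢ ((i+1)^{-w} - i^{-w}) A(i+1)`. [folklore] -/
theorem tendsto_sum_range_cpow_mul (hA : ∀ N, ‖∑ n ∈ range N, a n‖ ≤ M) {w : ℂ} (hw : 0 < w.re) :
    Tendsto (fun N => ∑ n ∈ range N, (n : ℂ) ^ (-w) * a n) atTop
      (𝓝 (-∑' i, ((((i + 1 : ℕ) : ℂ) ^ (-w)) - (i : ℂ) ^ (-w)) * ∑ n ∈ range (i + 1), a n)) :=
  (tendstoLocallyUniformlyOn_sum_range_cpow_mul hA).tendsto_at hw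

/-- Telescoping bound: `∑_{i<N} ‖(i+1)^{-u} - i^{-u}‖ ≤ 2` for real `u > 0` (the term `i = 0`
is `1`, the others telescope to `1 - N^{-u} ≤ 1`). [folklore] -/
theorem sum_range_norm_cpow_neg_succ_sub_le {u : ℝ} (hu : 0 < u) (N : ℕ) :
    ∑ i ∈ range N, ‖((i + 1 : ℕ) : ℂ) ^ (-(u : ℂ)) - (i : ℂ) ^ (-(u : ℂ))‖ ≤ 2 := by
  rcases N with _ | N
  · simp
  rw [Finset.sum_range_succ']
  have h0 : ‖((0 + 1 : ℕ) : ℂ) ^ (-(u : ℂ)) - ((0 : ℕ) : ℂ) ^ (-(u : ℂ))‖ = 1 := by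
    have hu0 : (u : ℂ) ≠ 0 := by exact_mod_cast hu.ne'
    rw [Nat.cast_zero, zero_cpow (neg_ne_zero.mpr hu0)]
    simp
  rw [h0]
  have htel : ∑ i ∈ range N, ‖((i + 1 + 1 : ℕ) : ℂ) ^ (-(u : ℂ)) - ((i + 1 : ℕ) : ℂ) ^ (-(u : ℂ))‖
      = ∑ i ∈ range N, (((i + 1 : ℕ) : ℝ) ^ (-u) - ((i + 1 + 1 : ℕ) : ℝ) ^ (-u)) := by
    refine Finset.sum_congr rfl fun i _ => ?_
    have := norm_cpow_neg_succ_sub_cpow_neg_ofReal (i := i + 1) (by omega) hu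
    push_cast at this ⊢
    exact this
  have htel' : ∑ i ∈ range N, (((i + 1 : ℕ) : ℝ) ^ (-u) - ((i + 1 + 1 : ℕ) : ℝ) ^ (-u)) =
      ((0 + 1 : ℕ) : ℝ) ^ (-u) - ((N + 1 : ℕ) : ℝ) ^ (-u) := by
    have := Finset.sum_range_sub' (fun i : ℕ => ((i + 1 : ℕ) : ℝ) ^ (-u)) N
    simpa using this
  have hnn : 0 ≤ ((N + 1 : ℕ) : ℝ) ^ (-u) := by positivity
  push_cast at htel htel' hnn ⊢
  rw [htel, htel', Real.one_rpow]
  linarith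

/-- **Uniform bound at real points.** If `‖A(N)‖ ≤ M` for all `N`, then for every real `u > 0`
the Abel sum, i.e. the value `∑ₙ aₙ n^{-u}`, has norm `≤ 2M`, uniformly in `u` (Abel's
inequality: the weights `n^{-u}` are positive and decreasing). [folklore] -/
theorem norm_abelSum_ofReal_le (hA : ∀ N, ‖∑ n ∈ range N, a n‖ ≤ M) {u : ℝ} (hu : 0 < u) :
    ‖-∑' i : ℕ, ((((i + 1 : ℕ) : ℂ) ^ (-(u : ℂ))) - (i : ℂ) ^ (-(u : ℂ))) * ∑ n ∈ range (i + 1), a n‖ ≤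
      2 * M := by
  have hM := nonneg_of_norm_psum_le hA
  have hu' : 0 < (u : ℂ).re := by simpa using hu
  have hs := summable_norm_abelTerm hA hu'
  rw [norm_neg]
  refine (norm_tsum_le_tsum_norm hs).trans ?_
  refine hs.tsum_le_of_sum_range_le fun N => ?_
  calc ∑ i ∈ range N, ‖((((i + 1 : ℕ) : ℂ) ^ (-(u : ℂ))) - (i : ℂ) ^ (-(u : ℂ))) * ∑ n ∈ range (i + 1), a n‖
      ≤ ∑ i ∈ range N, M * ‖((i + 1 : ℕ) : ℂ) ^ (-(u : ℂ)) - (i : ℂ) ^ (-(u : ℂ))‖ := by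
        refine Finset.sum_le_sum fun i _ => ?_
        rw [norm_mul, mul_comm M]
        exact mul_le_mul_of_nonneg_left (hA _) (norm_nonneg _)
    _ = M * ∑ i ∈ range N, ‖((i + 1 : ℕ) : ℂ) ^ (-(u : ℂ)) - (i : ℂ) ^ (-(u : ℂ))‖ := by
        rw [Finset.mul_sum]
    _ ≤ M * 2 := mul_le_mul_of_nonneg_left (sum_range_norm_cpow_neg_succ_sub_le hu N) hM
    _ = 2 * M := mul_comm _ _

end PartialEuler

end Literature.NumberTheory.LFunctions

end
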